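import Summits.CriticalPhenomena.PercolationContinuityZ3.Theorems.PercNearOneGluingAdditiveGluingFingerSetForm
import Summits.CriticalPhenomena.PercolationContinuityZ3.Theorems.PercNearOneGluingAdditiveGluingBasePeel
import Literature.Probability.Percolation.KozmaNitzanPreFKG
import HarnessLib

/-!
# `NoHeavyLowerTail` (stmt-CriticalPhenomena-4575) — block Question 9: the R-ONLY form and the Lemma-3(ii) transport leaf `(C_z)`

Support file (hull-port prover `prim-hp-1` gen 14; `--supports stmt-CriticalPhenomena-4575`).  No definitions, no named facts,
no sorries.  Memo: `run/shared/lean/prim/prim-hp-1/HULLPORT-COUPLING.md` §53(a), `CONJECTURES-gen14.md` §1.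

Setting: `w` the UNGLUED ranking graph (split graph of a depth-two observer), `O` a block (the hubs), `g := glue_O w`; `A` the relays,
anchor `a`, target `b`; `N := {a ↮ O}` (the anchor's cluster avoids the block), `Ob := ⋃_{o∈O} {o ↔ b}`, `OA := ⋃_{o∈O, x∈A} {o ↔ x}`
(all as sets of configurations; their `g`- and `w`-probabilities differ).

* `BlockQ9.glued_margin_ge_unglued` — the R-ONLY FORM (as an inequality, which is all that is needed):
  `μ_g(O ↔ b) − μ_g(a ↔ b, O ↔ A) ≥ μ_w(O ↔ b, a ↮ O) − μ_w(a ↔ b, a ↮ O, O ↔ A)`.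
  (Push forward along `ω ↦ ω ∪ clique(O)`: `{O ↔ b}` is invariant, and a glued path `a → b` either avoids the block or the anchor
  and `b` both touch the block.)  No hypothesis on `O`, `a`, `b` at all.
* `BlockQ9.blockQ9_of_lemma3ii_transport` — the LEAF `(C_z)`: if `μ_w(a ↔ b) ≤ μ_w(z ↔ b)` (one split row) and
  `μ_w(z ↔ b, a ↮ O) ≤ μ_w(O ↔ b, a ↮ O) + μ_w(a ↔ b, a ↮ O, ¬ O ↔ A)`, then `μ_g(a ↔ b, O ↔ A) ≤ μ_g(O ↔ b)` (block Question 9).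
  Proof: KN Lemma 3(ii) in the unglued graph with the decreasing event `{a ↮ O}` (`KozmaNitzan2024_lemma3_ii_notConn`) moves the
  anchor onto `z`; the rest is the R-only form.  Numerics (memo §53): for the K-weakest port `z = v` this leaf and the transfer leaf
  (`blockQ9_of_transfer`) together certify every two-hub instance tested (conjecture TC); each alone fails.
-/

namespace Summit.CriticalPhenomena.PercolationContinuityZ3.Theorems

open MeasureTheory Set
open Literature.Probability.LatticeModels
open Literature.Probability.Percolation

noncomputable section
open Classical

namespace BlockQ9

variable {n : ℕ}

/-- **R-only form of the block Question-9 margin.**  For any block `O`, anchor `a`, target `b`, relays `A` and unglued weights `w`,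
with `g = glue_O w`:  `μ_w(⋃_o {o↔b} ∩ {a ↮ O}) − μ_w({a↔b} ∩ {a ↮ O} ∩ ⋃_{o,x} {o↔x}) ≤ μ_g(⋃_o {o↔b}) − μ_g({a↔b} ∩ ⋃_{o,x} {o↔x})`.
[cite: KozmaNitzan2024, Lemma 5 (p. 13), Question 9 (p. 36)] -/
theorem glued_margin_ge_unglued (w : Sym2 (Fin n) → unitInterval) (O A : Finset (Fin n)) (a b : Fin n) :
    (prodBernoulli w).real ((⋃ o ∈ O, openConn o b) ∩ {ω | ∀ o ∈ (↑O : Set (Fin n)), ¬ (openGraph ω).Reachable a o}) -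
      (prodBernoulli w).real (openConn a b ∩ {ω | ∀ o ∈ (↑O : Set (Fin n)), ¬ (openGraph ω).Reachable a o} ∩
        ⋃ o ∈ O, ⋃ x ∈ A, openConn o x) ≤
    (prodBernoulli (fun e : Sym2 (Fin n) => if (∀ x ∈ e, x ∈ O) ∧ ¬ e.IsDiag then 1 else w e)).real (⋃ o ∈ O, openConn o b) -
      (prodBernoulli (fun e : Sym2 (Fin n) => if (∀ x ∈ e, x ∈ O) ∧ ¬ e.IsDiag then 1 else w e)).real
        (openConn a b ∩ ⋃ o ∈ O, ⋃ x ∈ A, openConn o x) := by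
  have hmeas : ∀ X : Set (BondConfig (Fin n)), MeasurableSet X := fun _ => MeasurableSet.of_discrete
  set μ := prodBernoulli w with hμ
  set D : Set (Sym2 (Fin n)) := {e : Sym2 (Fin n) | (∀ x ∈ e, x ∈ O) ∧ ¬ e.IsDiag} with hD
  set g : Sym2 (Fin n) → unitInterval := fun e : Sym2 (Fin n) => if (∀ x ∈ e, x ∈ O) ∧ ¬ e.IsDiag then (1 : unitInterval) else w e
    with hg
  set N : Set (BondConfig (Fin n)) := {ω | ∀ o ∈ (↑O : Set (Fin n)), ¬ (openGraph ω).Reachable a o} with hN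
  set Ob : Set (BondConfig (Fin n)) := ⋃ o ∈ O, openConn o b with hOb
  set OA : Set (BondConfig (Fin n)) := ⋃ o ∈ O, ⋃ x ∈ A, openConn o x with hOA
  set aO : Set (BondConfig (Fin n)) := {ω | ∃ o ∈ (↑O : Set (Fin n)), (openGraph ω).Reachable a o} with haO
  -- push-forward along `ω ↦ ω ∪ D`
  have h1 : ∀ e ∈ D, g e = 1 := fun e he => by simp only [hg]; rw [if_pos (by simpa [hD] using he)]
  have h2 : ∀ e ∉ D, g e = w e := fun e he => by simp only [hg]; rw [if_neg (by simpa [hD] using he)]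
  have hpush := fun E : Set (BondConfig (Fin n)) => glueSet_pushforward w g D h1 h2 E
  -- `Ob` is invariant
  have hObg : (prodBernoulli g).real Ob = μ.real Ob := by
    rw [hpush, show {ω : BondConfig (Fin n) | (ω ∪ D : BondConfig (Fin n)) ∈ Ob} = Ob from glue_preimage_iUnion_openConn O b]
  -- the pull-back of `{a ↔ b} ∩ OA` lies in `({a↔b} ∩ N ∩ OA) ∪ (aO ∩ Ob)`
  have hsub : {ω : BondConfig (Fin n) | (ω ∪ D : BondConfig (Fin n)) ∈ openConn a b ∩ OA} ⊆ (openConn a b ∩ N ∩ OA) ∪ (aO ∩ Ob) := by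
    intro ω hω
    obtain ⟨hab, hOAg⟩ := hω
    -- glued `O ↔ A` implies unglued `O ↔ A`
    have hOAw : ω ∈ OA := by
      rw [hOA] at hOAg ⊢
      simp only [Set.mem_iUnion] at hOAg ⊢
      obtain ⟨o, ho, x, hx, hox⟩ := hOAg
      rcases reachable_or_exists_mem_of_glue O (show (openGraph (ω ∪ D : BondConfig (Fin n))).Reachable o x from hox) with h | ⟨v, hv, hvx⟩
      · exact ⟨o, ho, x, hx, h⟩
      · exact ⟨v, hv, x, hx, hvx⟩
    -- glued `O ↔ b` from the side of `b` / unglued `a ↔ b`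
    have hab' : (openGraph (ω ∪ D : BondConfig (Fin n))).Reachable a b := hab
    by_cases hN' : ω ∈ N
    · -- the anchor avoids the block: the glued path is an unglued path
      left
      refine ⟨⟨?_, hN'⟩, hOAw⟩
      have hDO : ∀ e ∈ D, ∀ x ∈ e, x ∈ (↑O : Set (Fin n)) := fun e he x hx => by
        have := he.1 x hx; exact_mod_cast this
      exact reachable_of_union_of_avoids hDO hN' hab'
    · -- the anchor touches the block; then `O ↔ b` unglued
      right
      have haO' : ω ∈ aO := by
        rw [haO]; rw [hN] at hN'
        simp only [Set.mem_setOf_eq, not_forall, not_not] at hN' ⊢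
        obtain ⟨o, ho, h⟩ := hN'
        exact ⟨o, ho, h⟩
      refine ⟨haO', ?_⟩
      rw [hOb]; simp only [Set.mem_iUnion]
      rcases reachable_or_exists_mem_of_glue O hab' with h | ⟨v, hv, hvb⟩
      · obtain ⟨o, ho, hao⟩ := (by rw [haO] at haO'; exact haO' : ∃ o ∈ (↑O : Set (Fin n)), (openGraph ω).Reachable a o)
        exact ⟨o, ho, hao.symm.trans h⟩
      · exact ⟨v, hv, hvb⟩
  -- measure bookkeeping
  have hLg : (prodBernoulli g).real (openConn a b ∩ OA) ≤ μ.real (openConn a b ∩ N ∩ OA) + μ.real (aO ∩ Ob) := by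
    rw [hpush]
    exact (measureReal_mono hsub (measure_ne_top _ _)).trans (measureReal_union_le _ _)
  have hObsplit : μ.real Ob = μ.real (Ob ∩ N) + μ.real (Ob ∩ Nᶜ) := by
    rw [← measureReal_inter_add_sdiff (μ := prodBernoulli w) (s := Ob) (hmeas N) (measure_ne_top _ _), Set.sdiff_eq]
  have haOOb : μ.real (aO ∩ Ob) ≤ μ.real (Ob ∩ Nᶜ) := by
    refine measureReal_mono ?_ (measure_ne_top _ _)
    rintro ω ⟨h1, h2⟩
    refine ⟨h2, ?_⟩
    rw [haO] at h1; rw [hN]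
    simp only [Set.mem_compl_iff, Set.mem_setOf_eq, not_forall, not_not]
    obtain ⟨o, ho, h⟩ := h1
    exact ⟨o, ho, h⟩
  rw [hObg]
  linarith

/-- **Block Question 9 from one split row by Lemma-3(ii) transport (leaf `(C_z)`).**  Unglued graph `w`, block `O`, relays `A`, anchor `a`,
target `b`, any vertex `z` with `μ_w(a ↔ b) ≤ μ_w(z ↔ b)`.  If
`μ_w({z ↔ b} ∩ {a ↮ O}) ≤ μ_w(⋃_o {o ↔ b} ∩ {a ↮ O}) + μ_w({a ↔ b} ∩ {a ↮ O} ∩ (⋃_{o,x} {o ↔ x})ᶜ)`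
then `μ_{glue_O w}({a ↔ b} ∩ ⋃_{o,x}{o ↔ x}) ≤ μ_{glue_O w}(⋃_o {o ↔ b})`.  Proof: KN Lemma 3(ii) in `w` with the decreasing event
`{a ↮ O}` (`KozmaNitzan2024_lemma3_ii_notConn`) and `glued_margin_ge_unglued`. [cite: KozmaNitzan2024, Lemma 3(ii) (pp. 6–7), Question 9 (p. 36)] -/
theorem blockQ9_of_lemma3ii_transport (w : Sym2 (Fin n) → unitInterval) (O A : Finset (Fin n)) (a b z : Fin n)
    (hrow : (prodBernoulli w).real (openConn a b) ≤ (prodBernoulli w).real (openConn z b))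
    (hC : (prodBernoulli w).real (openConn z b ∩ {ω | ∀ o ∈ (↑O : Set (Fin n)), ¬ (openGraph ω).Reachable a o}) ≤
      (prodBernoulli w).real ((⋃ o ∈ O, openConn o b) ∩ {ω | ∀ o ∈ (↑O : Set (Fin n)), ¬ (openGraph ω).Reachable a o}) +
      (prodBernoulli w).real (openConn a b ∩ {ω | ∀ o ∈ (↑O : Set (Fin n)), ¬ (openGraph ω).Reachable a o} ∩
        (⋃ o ∈ O, ⋃ x ∈ A, openConn o x)ᶜ)) :
    (prodBernoulli (fun e : Sym2 (Fin n) => if (∀ x ∈ e, x ∈ O) ∧ ¬ e.IsDiag then 1 else w e)).real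
        (openConn a b ∩ ⋃ o ∈ O, ⋃ x ∈ A, openConn o x) ≤
      (prodBernoulli (fun e : Sym2 (Fin n) => if (∀ x ∈ e, x ∈ O) ∧ ¬ e.IsDiag then 1 else w e)).real
        (⋃ o ∈ O, openConn o b) := by
  have hmeas : ∀ X : Set (BondConfig (Fin n)), MeasurableSet X := fun _ => MeasurableSet.of_discrete
  have key := glued_margin_ge_unglued w O A a b
  -- Lemma 3(ii): move the anchor onto `z` on the event `{a ↮ O}`
  have L3 : (prodBernoulli w).real (openConn a b ∩ {ω | ∀ o ∈ (↑O : Set (Fin n)), ¬ (openGraph ω).Reachable a o}) ≤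
      (prodBernoulli w).real (openConn z b ∩ {ω | ∀ o ∈ (↑O : Set (Fin n)), ¬ (openGraph ω).Reachable a o}) :=
    KozmaNitzan2024_lemma3_ii_notConn w a z b (↑O : Set (Fin n)) hrow
  set μ := prodBernoulli w with hμ
  set N : Set (BondConfig (Fin n)) := {ω | ∀ o ∈ (↑O : Set (Fin n)), ¬ (openGraph ω).Reachable a o} with hN
  set OA : Set (BondConfig (Fin n)) := ⋃ o ∈ O, ⋃ x ∈ A, openConn o x with hOA
  -- `{a↔b} ∩ N` splits along `OA`
  have hsplit : μ.real (openConn a b ∩ N) = μ.real (openConn a b ∩ N ∩ OA) + μ.real (openConn a b ∩ N ∩ OAᶜ) := by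
    rw [← measureReal_inter_add_sdiff (μ := prodBernoulli w) (s := openConn a b ∩ N) (hmeas OA) (measure_ne_top _ _), Set.sdiff_eq]
  linarith

end BlockQ9

end

end Summit.CriticalPhenomena.PercolationContinuityZ3.Theorems
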